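import Literature.NumberTheory.EllipticCurves.ReductionHomomorphism
import Literature.NumberTheory.EllipticCurves.SingularCubic
import HarnessLib

/-!
# Reduction of the Tate normal form `y² + xy = x³ + a₆` (`a₆ ∈ 𝔪`): the split node `y² + xy = x³`
# and the explicit description of `E₀` and `E₁` by the valuation of `x`

`Proofs` file (theorems only, no definitions, no named facts) in topic
`NumberTheory/EllipticCurves`.  Let `R` be a local ring which is a valuation ring of the field `K`
(`hv : v.Integers R` for a valuation `v` of `K`, the setting of `ReductionHomomorphism`) and
`J : y² + xy = x³ + a₆` a Weierstrass equation over `R` in *Tate normal form*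
(`a₁ = 1`, `a₂ = a₃ = a₄ = 0`, `a₆ ∈ 𝔪`; the shape of the Tate curve `E_q`, Silverman, *ATAEC*,
V.3, and the normal form of every split multiplicative equation over a henselian ring,
`SplitMultiplicativeNormalForm`).  We record:

* `map_residue_eq_singularModel`: the reduction `J̃ = J mod 𝔪` is `y² + xy = x³`, i.e. the
  presented singular model `singularModel 0 0 0 (-1)` of `SingularCubic` — a **split node** at
  `(0, 0)` with the two rational tangent lines `y = 0`, `y = -x` (Silverman, *AEC*, III.1.4(a),
  VII.5.1(b): multiplicative reduction, split since the slopes lie in the prime field);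
* `nonsingular_iff_ne_zero_of_tateNormalForm`: a point `(x̄, ȳ)` of `J̃` is nonsingular iff
  `x̄ ≠ 0` (the only singular point is the node `(0, 0)`);
* `hasNonsingularReduction_some_iff_one_le` (**`E₀` explicitly**): an affine point `(x, y)` of
  `J(K)` has nonsingular reduction (`WeierstrassCurve.HasNonsingularReduction`, Silverman's
  `E₀(K)`, *AEC* VII.§2) iff `v x ≥ 1`, i.e. iff it does not reduce to the node — Silverman,
  *ATAEC*, V.4, Lemma 4.1.1 (`E₀ = {O} ∪ {P : |x(P)| ≥ 1}` on the Tate curve); the tree's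
  `K_v`-specific `TateNormalForm.IsBig` (`SplitMultiplicativeIndex`) is the same condition;
* `reducesToZero_some_iff_one_lt` (`E₁`): `(x, y)` reduces to `O` iff `v x > 1`;
* consequences for the unramified-layer files: `E₀` and `E₁` depend only on `v (x P)`, so they
  correspond under any map of points that preserves the valuation of the `x`-coordinate — two
  Tate normal forms over two valuation rings, e.g. along an unramified extension or an isometric
  automorphism (`hasNonsingularReduction_iff_of_v_eq`, `reducesToZero_iff_of_v_eq`).

## References

* [SilvermanATAEC1994] J. H. Silverman, *Advanced Topics in the Arithmetic of Elliptic Curves*,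
  GTM 151 (1994): V.3 Thm. 3.1 (the Tate curve `y² + xy = x³ + a₄x + a₆`), V.4 Lemma 4.1.1
  (PDF pp. 394, 402); Cor. IV.9.2(d).
* [SilvermanAEC2009] J. H. Silverman, *The Arithmetic of Elliptic Curves*, 2nd ed. (2009):
  Prop. III.1.4(a), III.2.5, VII.§2 (`E₀`, `E₁`), Prop. VII.5.1(b).

## Design

No definitions; `noncomputable section`; `open scoped Classical`; the general setting of
`ReductionHomomorphism` (`K` a field with a valuation `v : Valuation K Γ₀`, `R` a local ring with
`hv : v.Integers R`); the Tate normal form enters through the hypotheses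
`h1 : J.a₁ = 1`, `h2 : J.a₂ = 0`, `h3 : J.a₃ = 0`, `h4 : J.a₄ = 0`, `h6 : J.a₆ ∈ maximalIdeal R`
(no exponent is needed here).  Deliberate dot-notation extension of Mathlib's `WeierstrassCurve`
namespace, as in `ReductionHomomorphism`.
-/

noncomputable section

open scoped Classical

namespace WeierstrassCurve

open Literature.NumberTheory.EllipticCurves

/-! ### The reduced equation: the split node `y² + xy = x³` -/

section Residue

variable {R : Type*} [CommRing R] [IsLocalRing R] (J : WeierstrassCurve R)

/-- **The reduction of the Tate normal form is the split node `y² + xy = x³`**, presented as the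
singular model `singularModel 0 0 0 (-1)` (singular point `(0, 0)`, tangent slopes `0` and `-1`,
i.e. tangent cone `y (y + x)`).  Silverman, *AEC*, Prop. III.1.4(a) and VII.5.1(b).
[cite: SilvermanAEC2009, Prop. VII.5.1(b) and III.1.4(a)] -/
theorem map_residue_eq_singularModel (h1 : J.a₁ = 1) (h2 : J.a₂ = 0) (h3 : J.a₃ = 0)
    (h4 : J.a₄ = 0) (h6 : J.a₆ ∈ IsLocalRing.maximalIdeal R) :
    J.map (IsLocalRing.residue R) = singularModel 0 0 0 (-1) := by
  have h6' : IsLocalRing.residue R J.a₆ = 0 := (IsLocalRing.residue_eq_zero_iff _).mpr h6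
  ext
  · simp [h1]
  · simp [h2]
  · simp [h3]
  · simp [h4]
  · simp [h6']

/-- The tangent slopes `0 ≠ -1` of the reduced node are distinct (in every nontrivial ring).
[folklore] -/
theorem zero_ne_neg_one_residueField : (0 : IsLocalRing.ResidueField R) ≠ -1 := by
  rw [Ne, eq_comm, neg_eq_zero]
  exact one_ne_zero

end Residue

section Node

variable {k : Type*} [Field k]

/-- **The only singular point of `y² + xy = x³` is the node `(0, 0)`**: a point `(x̄, ȳ)` on a
Weierstrass cubic with `a₁ = 1`, `a₂ = a₃ = a₄ = a₆ = 0` is nonsingular iff `x̄ ≠ 0`.  (If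
`x̄ = 0` then `ȳ² = 0`; if `x̄ ≠ 0` and both partial derivatives vanished, `ȳ = 3x̄²` and
`2ȳ = -x̄` would give `6x̄ = -1` and, with the equation, `9x̄ = -2`, whence `1 = 0`.)
Silverman, *AEC*, Prop. III.1.4(a). [folklore] -/
theorem nonsingular_iff_ne_zero_of_tateNormalForm (W : WeierstrassCurve k) (h1 : W.a₁ = 1)
    (h2 : W.a₂ = 0) (h3 : W.a₃ = 0) (h4 : W.a₄ = 0) (h6 : W.a₆ = 0) {x y : k}
    (heq : W.toAffine.Equation x y) : W.toAffine.Nonsingular x y ↔ x ≠ 0 := by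
  have heq' : y ^ 2 + x * y = x ^ 3 := by
    have h := (WeierstrassCurve.Affine.equation_iff x y).mp heq
    have e1 : W.toAffine.a₁ = 1 := h1
    have e2 : W.toAffine.a₂ = 0 := h2
    have e3 : W.toAffine.a₃ = 0 := h3
    have e4 : W.toAffine.a₄ = 0 := h4
    have e6 : W.toAffine.a₆ = 0 := h6
    rw [e1, e2, e3, e4, e6] at h
    linear_combination h
  have key : W.toAffine.Nonsingular x y ↔ (y ≠ 3 * x ^ 2 ∨ y ≠ -y - x) := by
    rw [WeierstrassCurve.Affine.nonsingular_iff]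
    have e1 : W.toAffine.a₁ = 1 := h1
    have e2 : W.toAffine.a₂ = 0 := h2
    have e3 : W.toAffine.a₃ = 0 := h3
    have e4 : W.toAffine.a₄ = 0 := h4
    rw [e1, e2, e3, e4]
    simp only [one_mul, mul_zero, zero_mul, add_zero, sub_zero]
    exact and_iff_right heq
  rw [key]
  constructor
  · rintro hor hx
    subst hx
    have hy : y = 0 := by
      have : y ^ 2 = 0 := by linear_combination heq'
      exact (pow_eq_zero_iff two_ne_zero).mp this
    subst hy
    rcases hor with h | h
    · exact h (by ring)
    · exact h (by ring)
  · intro hx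
    by_contra hcon
    rw [not_or, not_ne_iff, not_ne_iff] at hcon
    obtain ⟨hA, hB⟩ := hcon
    have e1 : x * (6 * x + 1) = 0 := by linear_combination hB - 2 * hA
    have e2 : x ^ 3 * (9 * x + 2) = 0 := by linear_combination heq' - (y + 3 * x ^ 2 + x) * hA
    have e1' : 6 * x + 1 = 0 := (mul_eq_zero.mp e1).resolve_left hx
    have e2' : 9 * x + 2 = 0 := (mul_eq_zero.mp e2).resolve_left (pow_ne_zero 3 hx)
    have : (1 : k) = 0 := by linear_combination -(3 * e1' - 2 * e2')
    exact one_ne_zero this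

end Node

/-! ### `E₀` and `E₁` of the Tate normal form by the valuation of `x` -/

section Valuation

variable {K : Type*} [Field K] {Γ₀ : Type*} [LinearOrderedCommGroupWithZero Γ₀]
  {v : Valuation K Γ₀} {R : Type*} [CommRing R] [IsLocalRing R] [Algebra R K]
  (J : WeierstrassCurve R)

omit [IsLocalRing R] in
/-- **`E₁` of the Tate normal form (indeed of any integral equation): `(x, y)` reduces to `O` iff
`v x > 1`.**  Silverman, *AEC*, VII.§2. [folklore] -/
theorem reducesToZero_some_iff_one_lt (hv : v.Integers R) {x y : K}
    (h : (J.baseChange K).toAffine.Nonsingular x y) :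
    J.ReducesToZero (.some x y h) ↔ 1 < v x := by
  rw [reducesToZero_some_iff, not_mem_range_iff hv]

/-- **`E₀` of the Tate normal form: `(x, y) ∈ E₀(K) ↔ v x ≥ 1`.**  For `J : y² + xy = x³ + a₆`
with `a₆ ∈ 𝔪` over a valuation ring `R` of `K`, an affine point `(x, y) ∈ J(K)` has nonsingular
reduction iff `v x ≥ 1`: if `v x > 1` it reduces to `O`; if `v x ≤ 1` then `x, y ∈ R` and
`(x̄, ȳ)` is nonsingular on `ỹ² + x̄ỹ = x̄³` iff `x̄ ≠ 0` iff `v x = 1`.  Silverman, *ATAEC*, V.4,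
Lemma 4.1.1 (on the Tate curve, `E₀(K)` consists of `O` and the points with `|x| ≥ 1`); *AEC*
VII.§2. [cite: SilvermanATAEC1994, V.4 Lemma 4.1.1 (PDF p. 402)] -/
theorem hasNonsingularReduction_some_iff_one_le (hv : v.Integers R) (h1 : J.a₁ = 1)
    (h2 : J.a₂ = 0) (h3 : J.a₃ = 0) (h4 : J.a₄ = 0) (h6 : J.a₆ ∈ IsLocalRing.maximalIdeal R)
    {x y : K} (h : (J.baseChange K).toAffine.Nonsingular x y) :
    J.HasNonsingularReduction (.some x y h) ↔ 1 ≤ v x := by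
  by_cases hx : v x ≤ 1
  · obtain ⟨a, rfl⟩ := hv.exists_of_le_one hx
    obtain ⟨b, rfl⟩ := hv.exists_of_le_one (v_Y_le_one_of_v_X_le_one hv h.1 hx)
    rw [hasNonsingularReduction_some_algebraMap_iff hv.hom_inj h]
    have heq : (J.map (IsLocalRing.residue R)).toAffine.Equation (IsLocalRing.residue R a)
        (IsLocalRing.residue R b) := by
      have hab : J.toAffine.Equation a b := (map_equation_iff hv.hom_inj).mp h.1
      exact hab.map (IsLocalRing.residue R)
    rw [nonsingular_iff_ne_zero_of_tateNormalForm (J.map (IsLocalRing.residue R))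
      (by rw [map_a₁, h1, map_one]) (by rw [map_a₂, h2, map_zero]) (by rw [map_a₃, h3, map_zero])
      (by rw [map_a₄, h4, map_zero]) (by rw [map_a₆]; exact (IsLocalRing.residue_eq_zero_iff _).mpr h6)
      heq, ← v_algebraMap_eq_one_iff hv]
    exact ⟨fun h ↦ h.ge, fun h ↦ le_antisymm hx h⟩
  · rw [not_le] at hx
    exact ⟨fun _ ↦ hx.le, fun _ ↦ Or.inl ((not_mem_range_iff hv).mpr hx)⟩

/-- **Membership in `E₀` of the Tate normal form depends only on `v (x P)`**: for two Tate normal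
forms `J`, `J'` over valuation rings `R ⊆ K`, `R' ⊆ K'` and affine points `(x, y) ∈ J(K)`,
`(x', y') ∈ J'(K')` with `v' x' ≥ 1 ↔ v x ≥ 1`, one lies in `E₀` iff the other does.  (Used along
unramified extensions `K ⊆ K'` and for isometric automorphisms.)  Silverman, *ATAEC*, V.4,
Lemma 4.1.1. [folklore] -/
theorem hasNonsingularReduction_iff_of_v_eq (hv : v.Integers R) (h1 : J.a₁ = 1) (h2 : J.a₂ = 0)
    (h3 : J.a₃ = 0) (h4 : J.a₄ = 0) (h6 : J.a₆ ∈ IsLocalRing.maximalIdeal R)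
    {K' : Type*} [Field K'] {Γ₀' : Type*} [LinearOrderedCommGroupWithZero Γ₀']
    {v' : Valuation K' Γ₀'} {R' : Type*} [CommRing R'] [IsLocalRing R'] [Algebra R' K']
    (J' : WeierstrassCurve R') (hv' : v'.Integers R') (h1' : J'.a₁ = 1) (h2' : J'.a₂ = 0)
    (h3' : J'.a₃ = 0) (h4' : J'.a₄ = 0) (h6' : J'.a₆ ∈ IsLocalRing.maximalIdeal R')
    {x y : K} (h : (J.baseChange K).toAffine.Nonsingular x y)
    {x' y' : K'} (h' : (J'.baseChange K').toAffine.Nonsingular x' y')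
    (hxx' : 1 ≤ v' x' ↔ 1 ≤ v x) :
    J'.HasNonsingularReduction (.some x' y' h') ↔ J.HasNonsingularReduction (.some x y h) := by
  rw [J.hasNonsingularReduction_some_iff_one_le hv h1 h2 h3 h4 h6 h,
    J'.hasNonsingularReduction_some_iff_one_le hv' h1' h2' h3' h4' h6' h', hxx']

omit [IsLocalRing R] in
/-- The same for `E₁`: `(x', y') ∈ E₁ ↔ (x, y) ∈ E₁` as soon as `v' x' > 1 ↔ v x > 1` (any
integral equations). [folklore] -/
theorem reducesToZero_iff_of_v_eq (hv : v.Integers R)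
    {K' : Type*} [Field K'] {Γ₀' : Type*} [LinearOrderedCommGroupWithZero Γ₀']
    {v' : Valuation K' Γ₀'} {R' : Type*} [CommRing R'] [Algebra R' K']
    (J' : WeierstrassCurve R') (hv' : v'.Integers R')
    {x y : K} (h : (J.baseChange K).toAffine.Nonsingular x y)
    {x' y' : K'} (h' : (J'.baseChange K').toAffine.Nonsingular x' y')
    (hxx' : 1 < v' x' ↔ 1 < v x) :
    J'.ReducesToZero (.some x' y' h') ↔ J.ReducesToZero (.some x y h) := by
  rw [J.reducesToZero_some_iff_one_lt hv h, J'.reducesToZero_some_iff_one_lt hv' h', hxx']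

/-- **The bad points of the Tate normal form**: `(x, y) ∉ E₀(K)` iff `v x < 1`, and then also
`v y < 1` (`y (x + y) = x³ + a₆ ∈ 𝔪`) — the points reducing to the node `(0, 0)`.  Silverman,
*ATAEC*, V.4, Lemma 4.1.2. [folklore] -/
theorem not_hasNonsingularReduction_some_iff (hv : v.Integers R) (h1 : J.a₁ = 1) (h2 : J.a₂ = 0)
    (h3 : J.a₃ = 0) (h4 : J.a₄ = 0) (h6 : J.a₆ ∈ IsLocalRing.maximalIdeal R)
    {x y : K} (h : (J.baseChange K).toAffine.Nonsingular x y) :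
    ¬ J.HasNonsingularReduction (.some x y h) ↔ v x < 1 := by
  rw [J.hasNonsingularReduction_some_iff_one_le hv h1 h2 h3 h4 h6 h, not_le]

/-- For a bad point `(x, y)` (`v x < 1`) of the Tate normal form also `v y < 1`. [folklore] -/
theorem v_Y_lt_one_of_v_X_lt_one (hv : v.Integers R) (h1 : J.a₁ = 1) (h2 : J.a₂ = 0)
    (h3 : J.a₃ = 0) (h4 : J.a₄ = 0) (h6 : J.a₆ ∈ IsLocalRing.maximalIdeal R)
    {x y : K} (h : (J.baseChange K).toAffine.Nonsingular x y) (hx : v x < 1) : v y < 1 := by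
  obtain ⟨a, rfl⟩ := hv.exists_of_le_one hx.le
  obtain ⟨b, rfl⟩ := hv.exists_of_le_one (v_Y_le_one_of_v_X_le_one hv h.1 hx.le)
  rw [v_algebraMap_lt_one_iff hv] at hx ⊢
  -- reduce the equation: `b̄² + ā b̄ = ā³` with `ā = 0`
  have hab : J.toAffine.Equation a b := (map_equation_iff hv.hom_inj).mp h.1
  have heq := (WeierstrassCurve.Affine.equation_iff _ _).mp (hab.map (IsLocalRing.residue R))
  simp only [map_a₁, map_a₂, map_a₃, map_a₄, map_a₆, h1, h2, h3, h4, map_one, map_zero,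
    (IsLocalRing.residue_eq_zero_iff _).mpr h6, hx] at heq
  have : IsLocalRing.residue R b ^ 2 = 0 := by linear_combination heq
  exact (pow_eq_zero_iff two_ne_zero).mp this

end Valuation

end WeierstrassCurve

end
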